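import Summits.FinalStateConjecture.FinalStateConjecture.Theorems.SwallowTheDatumUniversalWitnessFamilyStubModelData
import Summits.FinalStateConjecture.FinalStateConjecture.Theorems.SwallowTheDatumUniversalWitnessFamilyStubSchwOutSite
import Summits.FinalStateConjecture.FinalStateConjecture.Theorems.SwallowTheDatumUniversalWitnessFamilyStubCapEnd
import Summits.FinalStateConjecture.FinalStateConjecture.Theorems.SwallowTheDatumUniversalWitnessFamilyStubPlugDataPlusSharpOf
import Summits.FinalStateConjecture.FinalStateConjecture.Theorems.SwallowTheDatumUniversalWitnessFamilyStubUniversalSocketBagOfPlugDataPlusSharp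
import Summits.FinalStateConjecture.FinalStateConjecture.Theses.SwallowTheDatum
import HarnessLib

/-!
# Route item `SwallowTheDatum.UniversalSocketBag` (stmt-FinalStateConjecture-15426, the DEEP universal socket bag) —
# REDUCTION TO THE PRINTED GLUING THEOREM AND THE BULK (line `Sketch` of crux 10051, continuation lead c2, wave 2)

The deep universal socket bag (vacuum off the unit ball, canonical Schwarzschild(`μ`) socket on `{1 < ‖y‖ < 2}`, EXACT isotropic
Schwarzschild(`M`) beyond `R₁` with `2 < R₁`, `40 R₁ < M`) follows from the printed, vendored Mao–Oh–Tao theorem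
`Literature.Geometry.Lorentzian.MaoOhTao.ObstructionFreeAnnularGluing` (arXiv:2308.13031 Thm 1.7 + Rem 1.9, BY NAME — conditional) and ONE
explicit-analysis statement, the Brill–Lindquist bulk with its `N + 2` Thm-1.7 sites (`BulkAt`, repaired quantifier), through the LANDED
chain of line `Sketch`: cap (`stub_capEnd`), model data (`stub_modelData`), Schwarzschild site (`stub_schwOutSite`), sharp PlugData⁺
(`stub_plugDataPlusSharp_of`, socket scale `16384 λ < ρ₃`) and the deep radial stretch (`stub_universalSocketBag_of_plugDataPlusSharp`,
`M = 160`, `R₁ = max 3.9 ρ₃`).  CONDITIONAL; credits nothing by itself; displays what item 15426 still owes: the printed theorem and the bulk.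
-/

-- `Summit.<Summit>.<Problem>` is the tree's mandated summit-side namespace (CONVENTIONS §2); for this
-- single-conjunct summit the two coincide, so the duplicate is deliberate.
set_option linter.dupNamespace false

noncomputable section

namespace Summit.FinalStateConjecture.FinalStateConjecture.Theorems.SwallowTheDatum.UniversalWitnessFamily.SheetLine

open scoped Manifold ContDiff Topology InnerProductSpace
open Set Filter Function Literature.Geometry.Lorentzian
open Literature.Geometry.Lorentzian.MaoOhTao Literature.Geometry.Lorentzian.InitialDataSet
open Summit.FinalStateConjecture.FinalStateConjecture.Theses.SwallowTheDatum (UniversalSocketBag)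
open Summit.FinalStateConjecture.FinalStateConjecture.Theorems.SwallowTheDatum.ParametricKerrBurial (BulkAt)

/-- **The deep universal socket bag (route item `UniversalSocketBag`) from the printed gluing theorem and the bulk**, through the landed
chain of line `Sketch` (cap, model data, Schwarzschild site, sharp PlugData⁺, deep stretch). [cite: MaoOhTao2023, Thm 1.7] -/
theorem universalSocketBag_of_obstructionFreeAnnularGluing_of_bulkAt :
    ObstructionFreeAnnularGluing →
    (∀ η : ℝ → ℝ, IsBump η → ∀ (εo μo M : ℝ), 0 < εo → 0 < μo → 0 < M →
      ∃ μ'₀ : ℝ, 0 < μ'₀ ∧ ∀ μ' : ℝ, 0 < μ' → μ' ≤ μ'₀ → BulkAt η εo μo M μ') →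
    UniversalSocketBag :=
  fun hMOT hBulk ↦
    stub_universalSocketBag_of_plugDataPlusSharp
      (stub_plugDataPlusSharp_of hMOT stub_capEnd stub_modelData.1 stub_modelData.2 stub_schwOutSite hBulk)

end Summit.FinalStateConjecture.FinalStateConjecture.Theorems.SwallowTheDatum.UniversalWitnessFamily.SheetLine

end
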